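import Summits.RiemannHypothesis.RiemannHypothesis.Theorems.UniversalFactorLehmerQuadrature
import Summits.RiemannHypothesis.RiemannHypothesis.Theorems.UniversalFactorLehmerCoreBounds
import Summits.RiemannHypothesis.RiemannHypothesis.Theorems.UniversalFactorLehmerTails

/-!
# RiemannHypothesis / UniversalFactor — the cell estimate and the analytic assembly of the
Lehmer-pair certificate for `LehmerPointNoGo`

Route `RiemannHypothesis/UniversalFactor`, item `LehmerPointNoGo` (stmt-RiemannHypothesis-2582).
With `g_κ(t) = Re H_0(2t) · e^{−κ(t − t₀)}` (`κ = ∓32`: the integrands of the backward/forward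
Laplace(16) averages of `H_0` at `x₀ = 2t₀` in the variable `t = (x₀ ∓ y)/2`), this file proves:

* `UniversalFactor.lehmer_mu_bounds` — for `t₀ ≥ 7000`, `|t − t₀| ≤ 1` the factor `μ` of
  `deBruijnH_zero_two_mul_repr` satisfies `|1/μ − 1| ≤ 10⁻⁷`;
* `UniversalFactor.lehmer_pointwise` — `|g_κ(t) + K₀ Re F_κ(½+it)| ≤ 10⁻⁷ K₀ ‖F_κ(½+it)‖`,
  `F_κ = lehmerF t₀ κ`;
* `UniversalFactor.lehmer_cell` — **the cell estimate**: on `[T − ρ, T + ρ]` (`ρ ≤ 1/20`,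
  `|T − t₀| ≤ 9/10`), for ANY nodes `u j ∈ [−ρ, ρ]` and real weights `W j`,
  `|∫ g_κ + K₀ Re Σ_j W_j F_κ(½ + i(T + u_j))| ≤ K₀ (M_disc · quadDefect + 2ρ · 10⁻⁷ · M_seg)` with the
  explicit `M_disc`, `M_seg` of `UniversalFactorLehmerCoreBounds.lean` and the exactly computable
  `quadDefect` of the rule (`UniversalFactor.quadrature_error_le`);
* `UniversalFactor.lehmerPointNoGo_of_main_integrals` — **assembly**: `LehmerPointNoGo` follows from
  `7000 ≤ t₀ ≤ 7010`, two explicit tail inequalities, `Re lehmerCore t₀ (½ + it₀) > 0`, and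
  `∫_{t₀−0.9}^{t₀} g_{−32} > 5K₀`, `∫_{t₀}^{t₀+0.9} g_{32} > 5K₀` (dip certificate
  `UniversalFactor.not_hasOnlyRealZeros_of_dip_certificate`: `H_0(x₀) < 0 < P, Q`).

The certified computation (`UniversalFactorLehmerChecker.lean`) establishes exactly these hypotheses
at `t₀ = 7005.08`.
-/

noncomputable section

set_option linter.dupNamespace false

namespace Summit.RiemannHypothesis.RiemannHypothesis.Theorems

open Complex Real Set MeasureTheory intervalIntegral Metric Finset
open Literature.NumberTheory.LFunctions
open Literature.Analysis.SpecialFunctions.Complex (stirlingPrim)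

/-! ## `|1/μ − 1| ≤ 10⁻⁷` -/

/-- Numerical bounds for the phase and segment errors at height `≈ 7000`: `d ≤ 1.7·10⁻⁴`,
`0 ≤ e ≤ 2.2·10⁻⁸`. [folklore] -/
theorem UniversalFactor.lehmer_err_bounds {t₀ t : ℝ} (ht₀ : 7000 ≤ t₀) (ht : |t - t₀| ≤ 1) :
    0 ≤ UniversalFactor.lehmerPhaseErr t₀ ∧ UniversalFactor.lehmerPhaseErr t₀ ≤ 17 / 100000 ∧
    0 ≤ UniversalFactor.lehmerSegErr t₀ t ∧ UniversalFactor.lehmerSegErr t₀ t ≤ 22 / 1000000000 := by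
  have hπ := Real.pi_lt_d4
  have hπ0 := Real.pi_pos
  have ht' := abs_le.1 ht
  refine ⟨?_, ?_, ?_, ?_⟩
  · unfold UniversalFactor.lehmerPhaseErr stirlingVertRate; positivity
  · unfold UniversalFactor.lehmerPhaseErr stirlingVertRate
    rw [div_le_iff₀ (by linarith)]
    nlinarith
  · unfold UniversalFactor.lehmerSegErr
    have : 0 < min t t₀ / 2 := by
      have := min_le_iff.not.2 (by push Not; constructor <;> linarith : ¬ (t ≤ 0 ∨ t₀ ≤ 0))
      rcases min_cases t t₀ with h | h <;> rw [h.1] <;> linarith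
    positivity
  · unfold UniversalFactor.lehmerSegErr
    set b : ℝ := min t t₀ / 2 with hb
    have hb1 : 3499 ≤ b := by
      rw [hb]; rcases min_cases t t₀ with h | h <;> rw [h.1] <;> linarith
    have hb0 : 0 < b := by linarith
    have h1 : 1 / (6 * b ^ 3) ≤ 1 / (6 * 3499 ^ 3) := by
      apply one_div_le_one_div_of_le (by norm_num)
      gcongr
    have h2 : π / (12 * b ^ 2) ≤ 3.1416 / (12 * 3499 ^ 2) := by
      gcongr
    have h3 : |t - t₀| / 2 ≤ 1 / 2 := by linarith
    have h4 : 0 ≤ 1 / (6 * b ^ 3) + π / (12 * b ^ 2) := by positivity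
    calc 2 * (1 / (6 * b ^ 3) + π / (12 * b ^ 2)) * (|t - t₀| / 2)
        ≤ 2 * (1 / (6 * 3499 ^ 3) + 3.1416 / (12 * 3499 ^ 2)) * (1 / 2) := by
          gcongr
    _ ≤ 22 / 1000000000 := by norm_num

/-- **`|1/μ − 1| ≤ 10⁻⁷`** for the representation factor `μ` of `deBruijnH_zero_two_mul_repr`, when
`t₀ ≥ 7000` and `|t − t₀| ≤ 1`; also `d + e ≤ π/2`. [folklore] -/
theorem UniversalFactor.lehmer_mu_bounds {t₀ t : ℝ} (ht₀ : 7000 ≤ t₀) (ht : |t - t₀| ≤ 1) :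
    UniversalFactor.lehmerPhaseErr t₀ + UniversalFactor.lehmerSegErr t₀ t ≤ π / 2 ∧
    ∀ μ : ℝ, Real.exp (-UniversalFactor.lehmerSegErr t₀ t) *
        Real.cos (UniversalFactor.lehmerPhaseErr t₀ + UniversalFactor.lehmerSegErr t₀ t) ≤ μ →
      μ ≤ Real.exp (UniversalFactor.lehmerSegErr t₀ t) → 0 < μ ∧ |1 / μ - 1| ≤ 1 / 10 ^ 7 := by
  obtain ⟨hd0, hd, he0, he⟩ := UniversalFactor.lehmer_err_bounds ht₀ ht
  set d := UniversalFactor.lehmerPhaseErr t₀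
  set e := UniversalFactor.lehmerSegErr t₀ t
  have hπ := Real.pi_gt_three
  refine ⟨by linarith, fun μ h1 h2 => ?_⟩
  -- lower bound for `μ`
  have hcos : 1 - (d + e) ^ 2 / 2 ≤ Real.cos (d + e) := Real.one_sub_sq_div_two_le_cos
  have hexp : 1 - e ≤ Real.exp (-e) := by linarith [Real.add_one_le_exp (-e)]
  have hsq : (d + e) ^ 2 ≤ (17 / 100000 + 22 / 1000000000) ^ 2 := by
    apply pow_le_pow_left₀ (by linarith); linarith
  have hμL : (1 - 22 / 1000000000) * (1 - (17 / 100000 + 22 / 1000000000) ^ 2 / 2) ≤ μ := by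
    refine le_trans ?_ h1
    have ha : (1 - 22 / 1000000000 : ℝ) ≤ Real.exp (-e) := le_trans (by linarith) hexp
    have hb : 1 - (17 / 100000 + 22 / 1000000000 : ℝ) ^ 2 / 2 ≤ Real.cos (d + e) :=
      le_trans (by linarith) hcos
    exact mul_le_mul ha hb (by norm_num) (Real.exp_pos _).le
  have hμpos : 0 < μ := lt_of_lt_of_le (by norm_num) hμL
  refine ⟨hμpos, abs_le.2 ⟨?_, ?_⟩⟩
  · -- `1/μ ≥ e^{-e} ≥ 1 - e`
    have h3 : Real.exp (-e) ≤ 1 / μ := by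
      rw [Real.exp_neg, ← one_div]
      exact one_div_le_one_div_of_le hμpos h2
    linarith
  · -- `1/μ ≤ 1/μ_L`
    have h3 : 1 / μ ≤ 1 / ((1 - 22 / 1000000000) * (1 - (17 / 100000 + 22 / 1000000000) ^ 2 / 2)) :=
      one_div_le_one_div_of_le (by norm_num) hμL
    have h4 : 1 / ((1 - 22 / 1000000000 : ℝ) * (1 - (17 / 100000 + 22 / 1000000000) ^ 2 / 2)) - 1 ≤
        1 / 10 ^ 7 := by norm_num
    linarith

/-! ## The pointwise estimate -/

/-- On the critical line the weight of `lehmerF` is the real number `e^{−κ(t − t₀)}`. [folklore] -/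
theorem UniversalFactor.lehmerF_half (t₀ κ t : ℝ) :
    UniversalFactor.lehmerF t₀ κ (1 / 2 + t * I) =
      UniversalFactor.lehmerCore t₀ (1 / 2 + t * I) * ((Real.exp (-κ * (t - t₀)) : ℝ) : ℂ) := by
  unfold UniversalFactor.lehmerF
  congr 1
  rw [Complex.ofReal_exp]
  congr 1
  push_cast
  ring_nf
  rw [Complex.I_sq]
  ring

/-- **Pointwise estimate**: for `t₀ ≥ 7000` and `|t − t₀| ≤ 1`,
`|Re H_0(2t) e^{−κ(t−t₀)} + K₀ Re F_κ(½+it)| ≤ 10⁻⁷ K₀ ‖F_κ(½+it)‖`. [folklore] -/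
theorem UniversalFactor.lehmer_pointwise {t₀ t : ℝ} (κ : ℝ) (ht₀ : 7000 ≤ t₀) (ht : |t - t₀| ≤ 1) :
    |(deBruijnH 0 ((2 * t : ℝ) : ℂ)).re * Real.exp (-κ * (t - t₀)) +
        UniversalFactor.lehmerK0 t₀ * (UniversalFactor.lehmerF t₀ κ (1 / 2 + t * I)).re| ≤
      UniversalFactor.lehmerK0 t₀ * (1 / 10 ^ 7) * ‖UniversalFactor.lehmerF t₀ κ (1 / 2 + t * I)‖ := by
  have ht' := abs_le.1 ht
  obtain ⟨hsmall, hμ⟩ := UniversalFactor.lehmer_mu_bounds ht₀ ht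
  obtain ⟨μ, hμ1, hμ2, hid⟩ := UniversalFactor.deBruijnH_zero_two_mul_repr (t₀ := t₀) (t := t)
    (by linarith) (by linarith) hsmall
  obtain ⟨hμpos, hη⟩ := hμ μ hμ1 hμ2
  have hK := UniversalFactor.lehmerK0_pos t₀
  set w : ℝ := Real.exp (-κ * (t - t₀)) with hw
  have hw0 : 0 < w := Real.exp_pos _
  set h : ℝ := (deBruijnH 0 ((2 * t : ℝ) : ℂ)).re
  set c : ℂ := UniversalFactor.lehmerCore t₀ (1 / 2 + t * I)
  have hF : UniversalFactor.lehmerF t₀ κ (1 / 2 + t * I) = c * (w : ℂ) := UniversalFactor.lehmerF_half t₀ κ t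
  have hFre : (UniversalFactor.lehmerF t₀ κ (1 / 2 + t * I)).re = c.re * w := by
    rw [hF, Complex.mul_re, Complex.ofReal_re, Complex.ofReal_im, mul_zero, sub_zero]
  have hFnorm : ‖UniversalFactor.lehmerF t₀ κ (1 / 2 + t * I)‖ = ‖c‖ * w := by
    rw [hF, norm_mul, Complex.norm_real, Real.norm_of_nonneg hw0.le]
  rw [hFre, hFnorm]
  -- `h w + K₀ c.re w = h w (1 - μ)` and `|1 - μ| ≤ 10⁻⁷ μ`
  have e1 : h * w + UniversalFactor.lehmerK0 t₀ * (c.re * w) = h * w * (1 - μ) := by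
    have : UniversalFactor.lehmerK0 t₀ * c.re = -(h * μ) := by linarith [hid]
    calc h * w + UniversalFactor.lehmerK0 t₀ * (c.re * w) = h * w + (UniversalFactor.lehmerK0 t₀ * c.re) * w := by ring
      _ = h * w * (1 - μ) := by rw [this]; ring
  rw [e1]
  have h1μ : |1 - μ| ≤ 1 / 10 ^ 7 * μ := by
    have : 1 - μ = μ * (1 / μ - 1) := by field_simp
    rw [this, abs_mul, abs_of_pos hμpos]
    calc μ * |1 / μ - 1| ≤ μ * (1 / 10 ^ 7) := mul_le_mul_of_nonneg_left hη hμpos.le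
      _ = 1 / 10 ^ 7 * μ := by ring
  have hcre : |c.re| ≤ ‖c‖ := Complex.abs_re_le_norm c
  calc |h * w * (1 - μ)| = |h| * w * |1 - μ| := by rw [abs_mul, abs_mul, abs_of_pos hw0]
    _ ≤ |h| * w * (1 / 10 ^ 7 * μ) := mul_le_mul_of_nonneg_left h1μ (by positivity)
    _ = 1 / 10 ^ 7 * w * |h * μ| := by rw [abs_mul, abs_of_pos hμpos]; ring
    _ = 1 / 10 ^ 7 * w * (UniversalFactor.lehmerK0 t₀ * |c.re|) := by
        rw [hid, abs_mul, abs_neg, abs_of_pos hK]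
    _ ≤ 1 / 10 ^ 7 * w * (UniversalFactor.lehmerK0 t₀ * ‖c‖) := by gcongr
    _ = UniversalFactor.lehmerK0 t₀ * (1 / 10 ^ 7) * (‖c‖ * w) := by ring

/-! ## The cell estimate -/

/-- **The cell estimate.** For `7000 ≤ t₀ ≤ 7010`, real `κ` (`= ∓32`), `0 < ρ ≤ 1/20`, `|T − t₀| ≤ 9/10`,
nodes `|u j| ≤ ρ`, real weights `W j`, any `K`, and `D₀ ≥ Re(F(¼+iT/2) − F(¼+it₀/2))`:
`|∫_{T−ρ}^{T+ρ} Re H_0(2t) e^{−κ(t−t₀)} dt + K₀ · Re Σ_j W_j F_κ(½ + i(T+u_j))|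
   ≤ K₀ (M_disc · quadDefect + 2ρ · 10⁻⁷ · M_seg)`. [folklore] -/
theorem UniversalFactor.lehmer_cell {t₀ κ T ρ D₀ : ℝ} {ι : Type*} (s : Finset ι) (u W : ι → ℝ) (K : ℕ)
    (ht₀ : 7000 ≤ t₀) (ht₀' : t₀ ≤ 7010) (hρ0 : 0 < ρ) (hρ : ρ ≤ 1 / 20)
    (hT : |T - t₀| ≤ 9 / 10) (hu : ∀ j ∈ s, |u j| ≤ ρ)
    (hD : (stirlingPrim (thetaArg T) - stirlingPrim (thetaArg t₀)).re ≤ D₀) :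
    |(∫ t in (T - ρ)..(T + ρ), (deBruijnH 0 ((2 * t : ℝ) : ℂ)).re * Real.exp (-κ * (t - t₀))) +
        UniversalFactor.lehmerK0 t₀ *
          (∑ j ∈ s, (W j : ℂ) * UniversalFactor.lehmerF t₀ κ (1 / 2 + ((T + u j : ℝ) : ℂ) * I)).re| ≤
      UniversalFactor.lehmerK0 t₀ * (UniversalFactor.lehmerMdisc t₀ κ T D₀ *
          UniversalFactor.quadDefect s u W ρ (1 / 4) K +
        2 * ρ * (1 / 10 ^ 7) * UniversalFactor.lehmerMseg t₀ κ T ρ D₀) := by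
  have hT' := abs_le.1 hT
  have hπ := Real.pi_lt_d2
  have hK := UniversalFactor.lehmerK0_pos t₀
  set c : ℂ := (1 : ℂ) / 2 + T * I with hc
  set Fl : ℝ → ℂ := fun t => UniversalFactor.lehmerF t₀ κ (1 / 2 + t * I) with hFl
  set g : ℝ → ℝ := fun t => (deBruijnH 0 ((2 * t : ℝ) : ℂ)).re * Real.exp (-κ * (t - t₀)) with hg
  set Mseg := UniversalFactor.lehmerMseg t₀ κ T ρ D₀ with hMseg
  set Mdisc := UniversalFactor.lehmerMdisc t₀ κ T D₀ with hMdisc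
  -- sup on the segment
  have hseg : ∀ t : ℝ, |t - T| ≤ ρ → ‖Fl t‖ ≤ Mseg := by
    intro t ht
    have h := UniversalFactor.norm_lehmerF_half_le (t₀ := t₀) (κ := κ) (T := T) (ρ := ρ) (D₀ := D₀)
      hρ0.le (by linarith) (by nlinarith) (by linarith) hD ht
    simpa [hFl, hMseg, UniversalFactor.lehmerMseg] using h
  have hMseg0 : 0 ≤ Mseg := (norm_nonneg _).trans (hseg T (by simp [hρ0.le]))
  -- pointwise
  have hpt : ∀ t ∈ Set.uIcc (T - ρ) (T + ρ),
      |g t + UniversalFactor.lehmerK0 t₀ * (Fl t).re| ≤ UniversalFactor.lehmerK0 t₀ * (1 / 10 ^ 7) * Mseg := by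
    intro t ht
    rw [Set.uIcc_of_le (by linarith), Set.mem_Icc] at ht
    have htT : |t - T| ≤ ρ := abs_le.2 ⟨by linarith, by linarith⟩
    have h := UniversalFactor.lehmer_pointwise κ ht₀ (t := t) (abs_le.2 ⟨by linarith, by linarith⟩)
    refine h.trans ?_
    exact mul_le_mul_of_nonneg_left (hseg t htT) (by positivity)
  -- continuity / integrability
  have hgc : Continuous g := by
    have h1 : Continuous fun t : ℝ => (deBruijnH 0 ((2 * t : ℝ) : ℂ)).re :=
      Complex.continuous_re.comp (continuous_deBruijnH_zero.comp (by fun_prop))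
    exact h1.mul (by fun_prop)
  have hdiff := UniversalFactor.differentiableOn_lehmerF t₀ κ (T := T) (R₁ := 3 / 10) (by norm_num) (by linarith)
  have hFlc : ContinuousOn Fl (Set.uIcc (T - ρ) (T + ρ)) := by
    have hmap : ∀ t ∈ Set.uIcc (T - ρ) (T + ρ), (1 : ℂ) / 2 + t * I ∈ ball c (3 / 10) := by
      intro t ht
      rw [Set.uIcc_of_le (by linarith), Set.mem_Icc] at ht
      rw [mem_ball, dist_eq_norm, hc, show (1 : ℂ) / 2 + t * I - (1 / 2 + T * I) = ((t - T : ℝ) : ℂ) * I by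
        push_cast; ring, norm_mul, Complex.norm_I, mul_one, Complex.norm_real, Real.norm_eq_abs]
      exact lt_of_le_of_lt (abs_le.2 ⟨by linarith, by linarith⟩ : |t - T| ≤ ρ) (by linarith)
    exact hdiff.continuousOn.comp (by fun_prop) hmap
  have hint_g : IntervalIntegrable g volume (T - ρ) (T + ρ) := hgc.intervalIntegrable _ _
  have hint_F : IntervalIntegrable Fl volume (T - ρ) (T + ρ) := hFlc.intervalIntegrable
  have hint_Fre : IntervalIntegrable (fun t => (Fl t).re) volume (T - ρ) (T + ρ) :=
    (Complex.continuous_re.comp_continuousOn hFlc).intervalIntegrable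
  -- (A) the `μ`-slop
  have hA : |(∫ t in (T - ρ)..(T + ρ), g t) + UniversalFactor.lehmerK0 t₀ * ∫ t in (T - ρ)..(T + ρ), (Fl t).re| ≤
      2 * ρ * (UniversalFactor.lehmerK0 t₀ * (1 / 10 ^ 7) * Mseg) := by
    rw [← intervalIntegral.integral_const_mul, ← intervalIntegral.integral_add hint_g (hint_Fre.const_mul _)]
    have h := intervalIntegral.norm_integral_le_of_norm_le_const (a := T - ρ) (b := T + ρ)
      (f := fun t => g t + UniversalFactor.lehmerK0 t₀ * (Fl t).re)
      (C := UniversalFactor.lehmerK0 t₀ * (1 / 10 ^ 7) * Mseg) (fun t ht => ?_)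
    · rw [Real.norm_eq_abs, show T + ρ - (T - ρ) = 2 * ρ by ring,
        abs_of_pos (by linarith : (0:ℝ) < 2 * ρ)] at h
      linarith
    · rw [Real.norm_eq_abs]
      exact hpt t (Set.uIoc_subset_uIcc ht)
  -- (B) quadrature
  have hshift : ∫ t in (T - ρ)..(T + ρ), (Fl t).re = (∫ x in (-ρ)..ρ, UniversalFactor.lehmerF t₀ κ (c + x * I)).re := by
    have h1 : ∫ t in (T - ρ)..(T + ρ), (Fl t).re = ∫ x in (-ρ)..ρ, (Fl (x + T)).re := by
      rw [intervalIntegral.integral_comp_add_right (fun t => (Fl t).re) T]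
      congr 1 <;> ring
    have h2 : (fun x : ℝ => Fl (x + T)) = fun x : ℝ => UniversalFactor.lehmerF t₀ κ (c + x * I) := by
      funext x; simp only [hFl, hc]; congr 1; push_cast; ring
    have hint2 : IntervalIntegrable (fun x : ℝ => UniversalFactor.lehmerF t₀ κ (c + x * I)) volume (-ρ) ρ := by
      rw [← h2]
      have := hint_F.comp_add_right T
      simpa using this
    rw [h1, show (fun x : ℝ => (Fl (x + T)).re) =
        fun x : ℝ => RCLike.re (UniversalFactor.lehmerF t₀ κ (c + (x : ℂ) * I)) by
      funext x; rw [show Fl (x + T) = UniversalFactor.lehmerF t₀ κ (c + x * I) from congrFun h2 x]; rfl,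
      intervalIntegral_re hint2]
    rfl
  have hquad := UniversalFactor.quadrature_error_le (f := UniversalFactor.lehmerF t₀ κ) (c := c)
    (R := 1 / 4) (R₁ := 3 / 10) (ρ := ρ) (M := Mdisc) hρ0.le (by linarith) (by norm_num) hdiff
    (fun z hz => by
      have h := UniversalFactor.norm_lehmerF_le_of_mem_sphere (t₀ := t₀) (κ := κ) (T := T) (R := 1 / 4)
        (D₀ := D₀) (by linarith) (by norm_num) le_rfl hD hz
      simpa [hMdisc, UniversalFactor.lehmerMdisc] using h) s u W hu K
  have hsum : (∑ j ∈ s, (W j : ℂ) * UniversalFactor.lehmerF t₀ κ (1 / 2 + ((T + u j : ℝ) : ℂ) * I)) =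
      ∑ j ∈ s, (W j : ℂ) * UniversalFactor.lehmerF t₀ κ (c + (u j : ℂ) * I) := by
    refine Finset.sum_congr rfl fun j _ => ?_
    congr 2; simp only [hc]; push_cast; ring
  have hB : |(∫ t in (T - ρ)..(T + ρ), (Fl t).re) -
      (∑ j ∈ s, (W j : ℂ) * UniversalFactor.lehmerF t₀ κ (1 / 2 + ((T + u j : ℝ) : ℂ) * I)).re| ≤
      Mdisc * UniversalFactor.quadDefect s u W ρ (1 / 4) K := by
    rw [hshift, hsum, ← Complex.sub_re]
    refine (Complex.abs_re_le_norm _).trans (hquad.trans (le_of_eq ?_))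
    rfl
  -- assemble
  have key : (∫ t in (T - ρ)..(T + ρ), g t) + UniversalFactor.lehmerK0 t₀ *
        (∑ j ∈ s, (W j : ℂ) * UniversalFactor.lehmerF t₀ κ (1 / 2 + ((T + u j : ℝ) : ℂ) * I)).re =
      ((∫ t in (T - ρ)..(T + ρ), g t) + UniversalFactor.lehmerK0 t₀ * ∫ t in (T - ρ)..(T + ρ), (Fl t).re) -
      UniversalFactor.lehmerK0 t₀ * ((∫ t in (T - ρ)..(T + ρ), (Fl t).re) -
        (∑ j ∈ s, (W j : ℂ) * UniversalFactor.lehmerF t₀ κ (1 / 2 + ((T + u j : ℝ) : ℂ) * I)).re) := by ring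
  rw [key]
  refine (abs_sub _ _).trans ?_
  rw [abs_mul, abs_of_pos hK]
  have := mul_le_mul_of_nonneg_left hB hK.le
  nlinarith [hA]

end Summit.RiemannHypothesis.RiemannHypothesis.Theorems
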